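import Summits.QuantumFields.BalabanUV.Beta.CapWordListGL
import Summits.QuantumFields.BalabanUV.Beta.ResolventResidualLeafRecord

/-!
# Beta / CapWordListGLSchedules — THE LANE'S FUNCTIONAL `G_L` OVER A KERNEL SCHEDULE WITH A GENERIC LEAF CERTIFICATE: the word-sum ∕ `G_L` typed
# targets with `hcert` as a HYPOTHESIS on the schedule's leaf list (any leaf currency), and the hG-FREE `G_L` target over residual records
# (β sub-cell, BINDER-OWNERS row CAP-k, lineage `b2b-balaban-beta-an5`, gen 27; node BETA-an5-g27-COEFF, leaf 3)

WHY.  The gen-26 word-sum anchors (`CapRouteAWordsRecords.rowsOfWordSumCode16E_ofRecords(_ofPairedBall)`, `CapWordListGL.rowsGL_ofRecords_ofPairedBall`)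
are keyed to ONE leaf currency — cap1's `BlockLeafRecord` with the closed-form hypothesis `hG`.  Since then the kernel holds FOUR per-leaf currencies with
the SAME conclusion `IsUnit (A q).det ∧ ‖(A q)⁻¹‖ ≤ Ba` on a box: block records + `hG` (p228449), residual records (p230938, hG-free; engine D's DLEAF
of record), residual-BLOCK records (gen 27 leaf 2, hG-free; engine D's DBLOCK) and residual records in COEFFICIENT currency (gen 27 leaf 1, sup step in
the kernel) — and a cover may MIX them leaf by leaf.  This module therefore states the lane's typed target ONCE over a kernel schedule with the leaf
certificate as a plain hypothesis
  `hcert : ∀ bx ∈ quarterBoxesQ κ R ν₀ ν₁ S', ∀ q ∈ Box bx.1 bx.2, IsUnit (A q).det ∧ ‖(A q)⁻¹‖ ≤ Ba`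
(coverage being the theorem `ResolventLeafRecord.hcov_of_schedulesQ`), so that EVERY currency — and any mixture, via `hcert_of_mixed` below — reaches
`G_L` BY NAME:
* §1 `hcert_of_mixed` — a cover whose leaves are certified by EITHER of two certificate families (decidable tag) is certified (the «mixed-cover glue»).
* §2 `stripRegularC_wordSum_ofSchedulesQ` — the (Z2) binder of the word sum over (kernel schedule, generic `hcert`, `hR`, fin schedules + leaves).
* §3 **`rowsOfWordSumCode16E_ofSchedulesQ_ofPairedBall`** (any word list `W`; the engines' PAIRED real ball; reality from `MatConjSymm`) and
  **`rowsGL_ofSchedulesQ_ofPairedBall`** (`W := wordListGL`, the lane's `G_L`) + `_k₀ = 0`.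
* §4 **`rowsGL_ofResidualRecords_ofPairedBall`** — the hG-FREE `G_L` TARGET: §3 with `hcert := hcert_of_residualRecords` (one `ResidualLeafRecord` per
  kernel leaf + the two sups) — engine D's admitted record format reaches the lane's functional with NO closed-form hypothesis anywhere.

HONEST FRAMING.  Kernel glue ([folklore]; compositions of tree theorems, no new analysis); no schedule instance, no record, no number supplied; 0 binders
of the real row instantiated; 0 certified coefficients; discharging `BetaPertH` would make Bałaban's ultraviolet stability UNCONDITIONAL — NOT the
continuum limit, NOT the Clay problem.  HONEST DEPENDENCY: continuum YM on T⁴ ⇐ BetaPertH ∧ nine spine estimates (0∕9 proved); BetaPertH ⇐ (D1) ∧ (D4)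
∧ CAP+tail; G-an2-4 gates asym, D1 and NE2∕3∕4.  0 `sorry`, 0 cite tags.
-/

namespace Summit.QuantumFields.BalabanUV.Beta.CapWordListGL

open Complex Set Matrix
open Literature.MathematicalPhysics.QuantumFieldTheory.Balaban1983to89
open B4Strip (Strip)
open B4ContourShift (latticeKernel StripRegular)
open B4TorusKernel (descend gridPt)
open Beta.AliasingTailL1 (aliasRatioL1 StripRegularC)
open Beta.AliasingTailLattice (codeTheta code16SetE)
open Summit.QuantumFields.BalabanUV.Beta.CapRows (Rows)
open Summit.QuantumFields.BalabanUV.Beta.TubeMaximumModulus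
open Summit.QuantumFields.BalabanUV.Beta.VertexToriSymmetry
open Summit.QuantumFields.BalabanUV.Beta.ConjReflectionAlgebra (MatConjSymm)
open Summit.QuantumFields.BalabanUV.Beta.ResolventBoxCertificate (Box)
open Summit.QuantumFields.BalabanUV.Beta.CapRowsLattice (rowsOfCode16E)
open Summit.QuantumFields.BalabanUV.Beta.CapRowsQhalf (rowsOfCode16E_ofRealBall sum_re_pairing)
open Summit.QuantumFields.BalabanUV.Beta.CoverSchedules
open Summit.QuantumFields.BalabanUV.Beta.ResolventLeafRecord (quarterBoxesQ hcov_of_schedulesQ)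
open Summit.QuantumFields.BalabanUV.Beta.ResolventResidualLeafRecord (ResidualLeafRecord hcert_of_residualRecords)
open Summit.QuantumFields.BalabanUV.Beta.CapRouteAWords
open Summit.QuantumFields.BalabanUV.Beta.CapRouteAWordsRecords
open scoped Real ComplexConjugate Matrix.Norms.L2Operator

noncomputable section

variable {n : Type*} [Fintype n] [DecidableEq n]

/-! ## §1 Mixed covers: two certificate families on one leaf list -/

section Mixed

variable {d : ℕ}

/-- **MIXED-COVER GLUE**: if every leaf of a list is certified by the first family where a decidable tag holds and by the second where it fails, the
whole list is certified — e.g. `BlockLeafRecord` leaves and `ResidualLeafRecord` leaves of ONE kernel schedule. [folklore] -/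
theorem hcert_of_mixed {boxes : Finset ((Fin (d + 1) → ℂ) × (Fin (d + 1) → ℝ))} (tag : (Fin (d + 1) → ℂ) × (Fin (d + 1) → ℝ) → Prop)
    [DecidablePred tag] {A : (Fin (d + 1) → ℂ) → Matrix n n ℂ} {Ba : ℝ}
    (h₁ : ∀ bx ∈ boxes.filter tag, ∀ q ∈ Box bx.1 bx.2, IsUnit (A q).det ∧ ‖(A q)⁻¹‖ ≤ Ba)
    (h₂ : ∀ bx ∈ boxes.filter (fun bx => ¬ tag bx), ∀ q ∈ Box bx.1 bx.2, IsUnit (A q).det ∧ ‖(A q)⁻¹‖ ≤ Ba) :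
    ∀ bx ∈ boxes, ∀ q ∈ Box bx.1 bx.2, IsUnit (A q).det ∧ ‖(A q)⁻¹‖ ≤ Ba := fun bx hbx => by
  by_cases ht : tag bx
  · exact h₁ bx (Finset.mem_filter.mpr ⟨hbx, ht⟩)
  · exact h₂ bx (Finset.mem_filter.mpr ⟨hbx, ht⟩)

/-- two budgets merge into their maximum. [folklore] -/
theorem hcert_mono {boxes : Finset ((Fin (d + 1) → ℂ) × (Fin (d + 1) → ℝ))} {A : (Fin (d + 1) → ℂ) → Matrix n n ℂ} {Ba Ba' : ℝ}
    (hle : Ba ≤ Ba') (h : ∀ bx ∈ boxes, ∀ q ∈ Box bx.1 bx.2, IsUnit (A q).det ∧ ‖(A q)⁻¹‖ ≤ Ba) :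
    ∀ bx ∈ boxes, ∀ q ∈ Box bx.1 bx.2, IsUnit (A q).det ∧ ‖(A q)⁻¹‖ ≤ Ba' := fun bx hbx q hq =>
  ⟨(h bx hbx q hq).1, (h bx hbx q hq).2.trans hle⟩

end Mixed

/-! ## §2 The (Z2) binder of a word sum over a kernel schedule with a generic leaf certificate -/

section Binder

variable {ι : Type*} {A : (Fin 4 → ℂ) → Matrix n n ℂ} {T : ι → (Fin 4 → ℂ) → Matrix n n ℂ} {κ Ba : ℝ} {S : ι → ℝ}

/-- **THE WORD-SUM (Z2) BINDER OVER (KERNEL SCHEDULE, GENERIC `hcert`, FIN SCHEDULES)** — any leaf currency. [folklore] -/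
theorem stripRegularC_wordSum_ofSchedulesQ (hκ : 0 < κ) (hA : MatTubeHol A (fun _ => κ)) (hT : ∀ i, MatTubeHol (T i) (fun _ => κ))
    (hAn : MatNegTranspose A) (hAc : MatConjSymm A)
    {R : ℚ} (hRπ : π ≤ (R : ℝ)) (ν₀ ν₁ : Fin (3 + 1)) (S' : (Fin (3 + 1) → Bool) → Sched 3)
    (hcert : ∀ bx ∈ quarterBoxesQ (fun _ : Fin (3 + 1) => κ) R ν₀ ν₁ S', ∀ q ∈ Box bx.1 bx.2, IsUnit (A q).det ∧ ‖(A q)⁻¹‖ ≤ Ba)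
    (hRfl : ∀ (ν : Fin (3 + 1)) (p : Fin (3 + 1) → ℂ), (A (reflectAt ν p)).det = (A p).det)
    (F : Fin (3 + 1) → Sched 1)
    (hcertF : ∀ (i : Fin (3 + 1)), ∀ bx ∈ finRects (F i), ∀ τ x : ℝ, |τ - bx.1 0| ≤ bx.2 0 → |x - bx.1 1| ≤ bx.2 1 →
      IsUnit (A (i.insertNth ((x : ℂ) + ((τ * κ : ℝ) : ℂ) * I) fun _ => ((τ * κ : ℝ) : ℂ) * I)).det)
    (hS : ∀ i, ∀ q ∈ VertexTori (fun _ : Fin (3 + 1) => κ), ‖T i q‖ ≤ S i) (W : List (ℝ × List ι)) :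
    StripRegularC (wordSum A T W) κ (wordSumBound n Ba S W) :=
  stripRegularC_wordSum_ofFinRects hκ hA hT hAn hAc ν₀ ν₁ (quarterBoxesQ (fun _ : Fin (3 + 1) => κ) R ν₀ ν₁ S') Prod.fst Prod.snd
    (hcov_of_schedulesQ _ hRπ ν₀ ν₁ S') hcert hRfl (fun i => finRects (F i))
    (fun _ bx => bx.1 0) (fun _ bx => bx.1 1) (fun _ bx => bx.2 0) (fun _ bx => bx.2 1) (hcovF_of_schedules F) hcertF hS W

end Binder

/-! ## §3 The word-sum and `G_L` targets over (kernel schedule, generic `hcert`) with the engines' paired ball -/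

section Rows

variable {ι : Type*} {b : ℕ → ℝ} {A : (Fin 4 → ℂ) → Matrix n n ℂ} {T : ι → (Fin 4 → ℂ) → Matrix n n ℂ} {κ Ba : ℝ} {S : ι → ℝ}

/-- **THE WORD-SUM TARGET OVER (KERNEL SCHEDULE, GENERIC LEAF CERTIFICATE) WITH THE PAIRED BALL** — any word list `W`, any leaf currency; reality
from `MatConjSymm A`, `MatConjSymm (T i)`. [folklore] -/
def rowsOfWordSumCode16E_ofSchedulesQ_ofPairedBall (W : List (ℝ × List ι)) (hb : b 0 = (latticeKernel (wordSum A T W) 0).re)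
    (hκ : 0 < κ) (hA : MatTubeHol A (fun _ => κ)) (hT' : ∀ i, MatTubeHol (T i) (fun _ => κ)) (hAn : MatNegTranspose A)
    (hAc : MatConjSymm A) (rT : ∀ i, MatConjSymm (T i))
    {R : ℚ} (hRπ : π ≤ (R : ℝ)) (ν₀ ν₁ : Fin (3 + 1)) (S' : (Fin (3 + 1) → Bool) → Sched 3)
    (hcert : ∀ bx ∈ quarterBoxesQ (fun _ : Fin (3 + 1) => κ) R ν₀ ν₁ S', ∀ q ∈ Box bx.1 bx.2, IsUnit (A q).det ∧ ‖(A q)⁻¹‖ ≤ Ba)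
    (hRfl : ∀ (ν : Fin (3 + 1)) (p : Fin (3 + 1) → ℂ), (A (reflectAt ν p)).det = (A p).det)
    (F : Fin (3 + 1) → Sched 1)
    (hcertF : ∀ (i : Fin (3 + 1)), ∀ bx ∈ finRects (F i), ∀ τ x : ℝ, |τ - bx.1 0| ≤ bx.2 0 → |x - bx.1 1| ≤ bx.2 1 →
      IsUnit (A (i.insertNth ((x : ℂ) + ((τ * κ : ℝ) : ℂ) * I) fun _ => ((τ * κ : ℝ) : ℂ) * I)).det)
    (hS : ∀ i, ∀ q ∈ VertexTori (fun _ : Fin (3 + 1) => κ), ‖T i q‖ ≤ S i)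
    {N : ℕ} (hN : 1 ≤ N) [NeZero (4 * N)] (S₀ Rp : Finset (Fin (3 + 1) → Fin (4 * N)))
    (hdec : code16SetE N = S₀ ∪ Rp ∪ Rp.image (fun w => -w)) (hd₁ : Disjoint S₀ Rp)
    (hd₂ : Disjoint S₀ (Rp.image fun w => -w)) (hd₃ : Disjoint Rp (Rp.image fun w => -w)) {t r : ℝ}
    (hTpair : |((code16SetE N).card : ℝ)⁻¹ *
        (∑ w ∈ S₀, (descend (wordSum A T W) (gridPt (4 * N) w)).re
          + 2 * ∑ w ∈ Rp, (descend (wordSum A T W) (gridPt (4 * N) w)).re) - t| ≤ r)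
    {A₀ : ℝ} (hA₀ : wordSumBound n Ba S W * codeTheta (aliasRatioL1 κ N) ≤ A₀) (lo : ℚ) (hlo : ((lo : ℚ) : ℝ) ≤ t - r - A₀) :
    Rows b :=
  have hreg := stripRegularC_wordSum_ofSchedulesQ hκ hA hT' hAn hAc hRπ ν₀ ν₁ S' hcert hRfl F hcertF hS W
  have hsym := (conjSymm_wordSum (A := A) (T := T) hAc rT W).hsym
  rowsOfCode16E_ofRealBall hb hreg hκ hsym hN
    (t := t) (r := r) (by
      rw [sum_re_pairing (hreg.toStripRegular hκ.le) hκ.le hsym S₀ Rp hdec hd₁ hd₂ hd₃]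
      exact hTpair)
    hA₀ lo hlo

/-- its level is `k₀ = 0`. [folklore] -/
theorem rowsOfWordSumCode16E_ofSchedulesQ_ofPairedBall_k₀ (W : List (ℝ × List ι)) (hb : b 0 = (latticeKernel (wordSum A T W) 0).re)
    (hκ : 0 < κ) (hA : MatTubeHol A (fun _ => κ)) (hT' : ∀ i, MatTubeHol (T i) (fun _ => κ)) (hAn : MatNegTranspose A)
    (hAc : MatConjSymm A) (rT : ∀ i, MatConjSymm (T i))
    {R : ℚ} (hRπ : π ≤ (R : ℝ)) (ν₀ ν₁ : Fin (3 + 1)) (S' : (Fin (3 + 1) → Bool) → Sched 3)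
    (hcert : ∀ bx ∈ quarterBoxesQ (fun _ : Fin (3 + 1) => κ) R ν₀ ν₁ S', ∀ q ∈ Box bx.1 bx.2, IsUnit (A q).det ∧ ‖(A q)⁻¹‖ ≤ Ba)
    (hRfl : ∀ (ν : Fin (3 + 1)) (p : Fin (3 + 1) → ℂ), (A (reflectAt ν p)).det = (A p).det)
    (F : Fin (3 + 1) → Sched 1)
    (hcertF : ∀ (i : Fin (3 + 1)), ∀ bx ∈ finRects (F i), ∀ τ x : ℝ, |τ - bx.1 0| ≤ bx.2 0 → |x - bx.1 1| ≤ bx.2 1 →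
      IsUnit (A (i.insertNth ((x : ℂ) + ((τ * κ : ℝ) : ℂ) * I) fun _ => ((τ * κ : ℝ) : ℂ) * I)).det)
    (hS : ∀ i, ∀ q ∈ VertexTori (fun _ : Fin (3 + 1) => κ), ‖T i q‖ ≤ S i)
    {N : ℕ} (hN : 1 ≤ N) [NeZero (4 * N)] (S₀ Rp : Finset (Fin (3 + 1) → Fin (4 * N)))
    (hdec : code16SetE N = S₀ ∪ Rp ∪ Rp.image (fun w => -w)) (hd₁ : Disjoint S₀ Rp)
    (hd₂ : Disjoint S₀ (Rp.image fun w => -w)) (hd₃ : Disjoint Rp (Rp.image fun w => -w)) {t r : ℝ}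
    (hTpair : |((code16SetE N).card : ℝ)⁻¹ *
        (∑ w ∈ S₀, (descend (wordSum A T W) (gridPt (4 * N) w)).re
          + 2 * ∑ w ∈ Rp, (descend (wordSum A T W) (gridPt (4 * N) w)).re) - t| ≤ r)
    {A₀ : ℝ} (hA₀ : wordSumBound n Ba S W * codeTheta (aliasRatioL1 κ N) ≤ A₀) (lo : ℚ) (hlo : ((lo : ℚ) : ℝ) ≤ t - r - A₀) :
    (rowsOfWordSumCode16E_ofSchedulesQ_ofPairedBall W hb hκ hA hT' hAn hAc rT hRπ ν₀ ν₁ S' hcert hRfl F hcertF hS hN S₀ Rp hdec hd₁ hd₂ hd₃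
      hTpair hA₀ lo hlo).k₀ = 0 := rfl

end Rows

section GLRows

variable {b : ℕ → ℝ} {A : (Fin 4 → ℂ) → Matrix n n ℂ} {T : Letter → (Fin 4 → ℂ) → Matrix n n ℂ} {κ Ba : ℝ} {S : Letter → ℝ}

/-- **THE LANE'S `G_L` TARGET OVER (KERNEL SCHEDULE, GENERIC LEAF CERTIFICATE) WITH THE PAIRED BALL**: `W := wordListGL`; `hcert` any currency
(block + hG, residual, residual-block, coefficient, or mixed by `hcert_of_mixed`). [folklore] -/
def rowsGL_ofSchedulesQ_ofPairedBall (hb : b 0 = (latticeKernel (gL A T) 0).re) (hκ : 0 < κ)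
    (hA : MatTubeHol A (fun _ => κ)) (hT' : ∀ i, MatTubeHol (T i) (fun _ => κ)) (hAn : MatNegTranspose A)
    (hAc : MatConjSymm A) (rT : ∀ i, MatConjSymm (T i))
    {R : ℚ} (hRπ : π ≤ (R : ℝ)) (ν₀ ν₁ : Fin (3 + 1)) (S' : (Fin (3 + 1) → Bool) → Sched 3)
    (hcert : ∀ bx ∈ quarterBoxesQ (fun _ : Fin (3 + 1) => κ) R ν₀ ν₁ S', ∀ q ∈ Box bx.1 bx.2, IsUnit (A q).det ∧ ‖(A q)⁻¹‖ ≤ Ba)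
    (hRfl : ∀ (ν : Fin (3 + 1)) (p : Fin (3 + 1) → ℂ), (A (reflectAt ν p)).det = (A p).det)
    (F : Fin (3 + 1) → Sched 1)
    (hcertF : ∀ (i : Fin (3 + 1)), ∀ bx ∈ finRects (F i), ∀ τ x : ℝ, |τ - bx.1 0| ≤ bx.2 0 → |x - bx.1 1| ≤ bx.2 1 →
      IsUnit (A (i.insertNth ((x : ℂ) + ((τ * κ : ℝ) : ℂ) * I) fun _ => ((τ * κ : ℝ) : ℂ) * I)).det)
    (hS : ∀ i, ∀ q ∈ VertexTori (fun _ : Fin (3 + 1) => κ), ‖T i q‖ ≤ S i)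
    {N : ℕ} (hN : 1 ≤ N) [NeZero (4 * N)] (S₀ Rp : Finset (Fin (3 + 1) → Fin (4 * N)))
    (hdec : code16SetE N = S₀ ∪ Rp ∪ Rp.image (fun w => -w)) (hd₁ : Disjoint S₀ Rp)
    (hd₂ : Disjoint S₀ (Rp.image fun w => -w)) (hd₃ : Disjoint Rp (Rp.image fun w => -w)) {t r : ℝ}
    (hTpair : |((code16SetE N).card : ℝ)⁻¹ *
        (∑ w ∈ S₀, (descend (gL A T) (gridPt (4 * N) w)).re + 2 * ∑ w ∈ Rp, (descend (gL A T) (gridPt (4 * N) w)).re) - t| ≤ r)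
    {A₀ : ℝ} (hA₀ : wordSumBound n Ba S wordListGL * codeTheta (aliasRatioL1 κ N) ≤ A₀) (lo : ℚ)
    (hlo : ((lo : ℚ) : ℝ) ≤ t - r - A₀) : Rows b :=
  rowsOfWordSumCode16E_ofSchedulesQ_ofPairedBall wordListGL hb hκ hA hT' hAn hAc rT hRπ ν₀ ν₁ S' hcert hRfl F hcertF hS hN S₀ Rp hdec hd₁
    hd₂ hd₃ hTpair hA₀ lo hlo

/-- its level is `k₀ = 0`. [folklore] -/
theorem rowsGL_ofSchedulesQ_ofPairedBall_k₀ (hb : b 0 = (latticeKernel (gL A T) 0).re) (hκ : 0 < κ)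
    (hA : MatTubeHol A (fun _ => κ)) (hT' : ∀ i, MatTubeHol (T i) (fun _ => κ)) (hAn : MatNegTranspose A)
    (hAc : MatConjSymm A) (rT : ∀ i, MatConjSymm (T i))
    {R : ℚ} (hRπ : π ≤ (R : ℝ)) (ν₀ ν₁ : Fin (3 + 1)) (S' : (Fin (3 + 1) → Bool) → Sched 3)
    (hcert : ∀ bx ∈ quarterBoxesQ (fun _ : Fin (3 + 1) => κ) R ν₀ ν₁ S', ∀ q ∈ Box bx.1 bx.2, IsUnit (A q).det ∧ ‖(A q)⁻¹‖ ≤ Ba)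
    (hRfl : ∀ (ν : Fin (3 + 1)) (p : Fin (3 + 1) → ℂ), (A (reflectAt ν p)).det = (A p).det)
    (F : Fin (3 + 1) → Sched 1)
    (hcertF : ∀ (i : Fin (3 + 1)), ∀ bx ∈ finRects (F i), ∀ τ x : ℝ, |τ - bx.1 0| ≤ bx.2 0 → |x - bx.1 1| ≤ bx.2 1 →
      IsUnit (A (i.insertNth ((x : ℂ) + ((τ * κ : ℝ) : ℂ) * I) fun _ => ((τ * κ : ℝ) : ℂ) * I)).det)
    (hS : ∀ i, ∀ q ∈ VertexTori (fun _ : Fin (3 + 1) => κ), ‖T i q‖ ≤ S i)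
    {N : ℕ} (hN : 1 ≤ N) [NeZero (4 * N)] (S₀ Rp : Finset (Fin (3 + 1) → Fin (4 * N)))
    (hdec : code16SetE N = S₀ ∪ Rp ∪ Rp.image (fun w => -w)) (hd₁ : Disjoint S₀ Rp)
    (hd₂ : Disjoint S₀ (Rp.image fun w => -w)) (hd₃ : Disjoint Rp (Rp.image fun w => -w)) {t r : ℝ}
    (hTpair : |((code16SetE N).card : ℝ)⁻¹ *
        (∑ w ∈ S₀, (descend (gL A T) (gridPt (4 * N) w)).re + 2 * ∑ w ∈ Rp, (descend (gL A T) (gridPt (4 * N) w)).re) - t| ≤ r)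
    {A₀ : ℝ} (hA₀ : wordSumBound n Ba S wordListGL * codeTheta (aliasRatioL1 κ N) ≤ A₀) (lo : ℚ)
    (hlo : ((lo : ℚ) : ℝ) ≤ t - r - A₀) :
    (rowsGL_ofSchedulesQ_ofPairedBall hb hκ hA hT' hAn hAc rT hRπ ν₀ ν₁ S' hcert hRfl F hcertF hS hN S₀ Rp hdec hd₁ hd₂ hd₃ hTpair hA₀ lo
      hlo).k₀ = 0 := rfl

/-! ## §4 The hG-FREE `G_L` target: residual records (engine D's admitted format) -/

/-- **THE hG-FREE `G_L` TARGET OVER (KERNEL SCHEDULE, RESIDUAL RECORDS)**: §3 with `hcert := hcert_of_residualRecords` — one `ResidualLeafRecord` per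
kernel leaf (valid, budget `≤ Ba`, leaf inside the record's box) + per record a preconditioner family with the two sups; NO closed-form hypothesis
anywhere in the binder list. [folklore] -/
def rowsGL_ofResidualRecords_ofPairedBall (hb : b 0 = (latticeKernel (gL A T) 0).re) (hκ : 0 < κ)
    (hA : MatTubeHol A (fun _ => κ)) (hT' : ∀ i, MatTubeHol (T i) (fun _ => κ)) (hAn : MatNegTranspose A)
    (hAc : MatConjSymm A) (rT : ∀ i, MatConjSymm (T i))
    {R : ℚ} (hRπ : π ≤ (R : ℝ)) (ν₀ ν₁ : Fin (3 + 1)) (S' : (Fin (3 + 1) → Bool) → Sched 3)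
    (rec : (Fin (3 + 1) → ℂ) × (Fin (3 + 1) → ℝ) → ResidualLeafRecord 3)
    (hvalid : ∀ bx ∈ quarterBoxesQ (fun _ : Fin (3 + 1) => κ) R ν₀ ν₁ S', (rec bx).Valid ∧ ((rec bx).B : ℝ) ≤ Ba)
    (hsub : ∀ bx ∈ quarterBoxesQ (fun _ : Fin (3 + 1) => κ) R ν₀ ν₁ S', Box bx.1 bx.2 ⊆ (rec bx).box)
    (P : (Fin (3 + 1) → ℂ) × (Fin (3 + 1) → ℝ) → (Fin (3 + 1) → ℂ) → Matrix n n ℂ)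
    (hres : ∀ bx ∈ quarterBoxesQ (fun _ : Fin (3 + 1) => κ) R ν₀ ν₁ S', ∀ q ∈ (rec bx).box, ‖1 - P bx q * A q‖ ≤ (rec bx).θ)
    (hP : ∀ bx ∈ quarterBoxesQ (fun _ : Fin (3 + 1) => κ) R ν₀ ν₁ S', ∀ q ∈ (rec bx).box, ‖P bx q‖ ≤ (rec bx).p)
    (hRfl : ∀ (ν : Fin (3 + 1)) (p : Fin (3 + 1) → ℂ), (A (reflectAt ν p)).det = (A p).det)
    (F : Fin (3 + 1) → Sched 1)
    (hcertF : ∀ (i : Fin (3 + 1)), ∀ bx ∈ finRects (F i), ∀ τ x : ℝ, |τ - bx.1 0| ≤ bx.2 0 → |x - bx.1 1| ≤ bx.2 1 →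
      IsUnit (A (i.insertNth ((x : ℂ) + ((τ * κ : ℝ) : ℂ) * I) fun _ => ((τ * κ : ℝ) : ℂ) * I)).det)
    (hS : ∀ i, ∀ q ∈ VertexTori (fun _ : Fin (3 + 1) => κ), ‖T i q‖ ≤ S i)
    {N : ℕ} (hN : 1 ≤ N) [NeZero (4 * N)] (S₀ Rp : Finset (Fin (3 + 1) → Fin (4 * N)))
    (hdec : code16SetE N = S₀ ∪ Rp ∪ Rp.image (fun w => -w)) (hd₁ : Disjoint S₀ Rp)
    (hd₂ : Disjoint S₀ (Rp.image fun w => -w)) (hd₃ : Disjoint Rp (Rp.image fun w => -w)) {t r : ℝ}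
    (hTpair : |((code16SetE N).card : ℝ)⁻¹ *
        (∑ w ∈ S₀, (descend (gL A T) (gridPt (4 * N) w)).re + 2 * ∑ w ∈ Rp, (descend (gL A T) (gridPt (4 * N) w)).re) - t| ≤ r)
    {A₀ : ℝ} (hA₀ : wordSumBound n Ba S wordListGL * codeTheta (aliasRatioL1 κ N) ≤ A₀) (lo : ℚ)
    (hlo : ((lo : ℚ) : ℝ) ≤ t - r - A₀) : Rows b :=
  rowsGL_ofSchedulesQ_ofPairedBall hb hκ hA hT' hAn hAc rT hRπ ν₀ ν₁ S' (hcert_of_residualRecords rec hvalid hsub P hres hP) hRfl F hcertF hS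
    hN S₀ Rp hdec hd₁ hd₂ hd₃ hTpair hA₀ lo hlo

/-- its level is `k₀ = 0`. [folklore] -/
theorem rowsGL_ofResidualRecords_ofPairedBall_k₀ (hb : b 0 = (latticeKernel (gL A T) 0).re) (hκ : 0 < κ)
    (hA : MatTubeHol A (fun _ => κ)) (hT' : ∀ i, MatTubeHol (T i) (fun _ => κ)) (hAn : MatNegTranspose A)
    (hAc : MatConjSymm A) (rT : ∀ i, MatConjSymm (T i))
    {R : ℚ} (hRπ : π ≤ (R : ℝ)) (ν₀ ν₁ : Fin (3 + 1)) (S' : (Fin (3 + 1) → Bool) → Sched 3)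
    (rec : (Fin (3 + 1) → ℂ) × (Fin (3 + 1) → ℝ) → ResidualLeafRecord 3)
    (hvalid : ∀ bx ∈ quarterBoxesQ (fun _ : Fin (3 + 1) => κ) R ν₀ ν₁ S', (rec bx).Valid ∧ ((rec bx).B : ℝ) ≤ Ba)
    (hsub : ∀ bx ∈ quarterBoxesQ (fun _ : Fin (3 + 1) => κ) R ν₀ ν₁ S', Box bx.1 bx.2 ⊆ (rec bx).box)
    (P : (Fin (3 + 1) → ℂ) × (Fin (3 + 1) → ℝ) → (Fin (3 + 1) → ℂ) → Matrix n n ℂ)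
    (hres : ∀ bx ∈ quarterBoxesQ (fun _ : Fin (3 + 1) => κ) R ν₀ ν₁ S', ∀ q ∈ (rec bx).box, ‖1 - P bx q * A q‖ ≤ (rec bx).θ)
    (hP : ∀ bx ∈ quarterBoxesQ (fun _ : Fin (3 + 1) => κ) R ν₀ ν₁ S', ∀ q ∈ (rec bx).box, ‖P bx q‖ ≤ (rec bx).p)
    (hRfl : ∀ (ν : Fin (3 + 1)) (p : Fin (3 + 1) → ℂ), (A (reflectAt ν p)).det = (A p).det)
    (F : Fin (3 + 1) → Sched 1)
    (hcertF : ∀ (i : Fin (3 + 1)), ∀ bx ∈ finRects (F i), ∀ τ x : ℝ, |τ - bx.1 0| ≤ bx.2 0 → |x - bx.1 1| ≤ bx.2 1 →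
      IsUnit (A (i.insertNth ((x : ℂ) + ((τ * κ : ℝ) : ℂ) * I) fun _ => ((τ * κ : ℝ) : ℂ) * I)).det)
    (hS : ∀ i, ∀ q ∈ VertexTori (fun _ : Fin (3 + 1) => κ), ‖T i q‖ ≤ S i)
    {N : ℕ} (hN : 1 ≤ N) [NeZero (4 * N)] (S₀ Rp : Finset (Fin (3 + 1) → Fin (4 * N)))
    (hdec : code16SetE N = S₀ ∪ Rp ∪ Rp.image (fun w => -w)) (hd₁ : Disjoint S₀ Rp)
    (hd₂ : Disjoint S₀ (Rp.image fun w => -w)) (hd₃ : Disjoint Rp (Rp.image fun w => -w)) {t r : ℝ}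
    (hTpair : |((code16SetE N).card : ℝ)⁻¹ *
        (∑ w ∈ S₀, (descend (gL A T) (gridPt (4 * N) w)).re + 2 * ∑ w ∈ Rp, (descend (gL A T) (gridPt (4 * N) w)).re) - t| ≤ r)
    {A₀ : ℝ} (hA₀ : wordSumBound n Ba S wordListGL * codeTheta (aliasRatioL1 κ N) ≤ A₀) (lo : ℚ)
    (hlo : ((lo : ℚ) : ℝ) ≤ t - r - A₀) :
    (rowsGL_ofResidualRecords_ofPairedBall hb hκ hA hT' hAn hAc rT hRπ ν₀ ν₁ S' rec hvalid hsub P hres hP hRfl F hcertF hS hN S₀ Rp hdec hd₁ hd₂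
      hd₃ hTpair hA₀ lo hlo).k₀ = 0 := rfl

end GLRows

end

end Summit.QuantumFields.BalabanUV.Beta.CapWordListGL
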